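import Mathlib.RingTheory.Ideal.Maps
import Mathlib.Algebra.Module.Torsion.Basic
import Mathlib.LinearAlgebra.Prod
import HarnessLib

/-!
# The module-theoretic skeleton of the plus argument II [Schoof2009, Exercise 14.1, Theorem 14.1]

[Schoof2009, Theorem 14.1] (*for odd primes `p > q` with `p ≢ 1 (mod q)` the `𝔽_q[G⁺]`-module
`S⁺` has a non-zero annihilator*) is proved on [Schoof2009, pp. 92–93] by a diagram chase whose
only arithmetic inputs are: the injection `S⁺ ↪ E₁ × E₃ × Cl⁺[q]` ([Schoof2009, Prop. 7.4] and
Prop. 13.1), Thaine's theorem in the form "the annihilator of `E₃ = E/CE^q` annihilates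
`Cl⁺[q]`" ([Schoof2009, Theorem 16.3] with Prop. 13.2), the freeness `E₁ × E₂ × E₃ ≅ E/E^q ≅ 𝔽_q[G⁺]`
([Schoof2009, Cor. 13.7] with Prop. 13.1) and `E₂ ≠ 0` ([Schoof2009, Prop. 14.2]). This file
proves the chase itself, for modules over an arbitrary commutative ring `R` in place of
`𝔽_q[G⁺]`:

* `Catalan.Plus.annihilator_sup_annihilator_eq_top` — **[Schoof2009, Exercise 14.1]**: if
  `A × B` is free of rank one then `Ann(A) + Ann(B) = R`;
* `Catalan.Plus.annihilator_ne_bot_of_embedding` — the skeleton of **[Schoof2009, Theorem 14.1]**: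
  if `S ↪ E₁ × E₃ × C` (`R`-linearly), `Ann(E₃) ⊆ Ann(C)`, `(E₁ × E₃) × E₂ ≅ R` and `E₂ ≠ 0`, then
  `Ann(S) ≠ 0`.

Everything is proved; no definitions.

## References

* R. Schoof, *Catalan's Conjecture*, Universitext, Springer 2009 [Schoof2009], Theorem 14.1 and
  Exercise 14.1 (book pp. 92–94) — held, `lit read book:schoof2009-catalan-s-conjecture`
  (PDF pp. 170–172).
* P. Mihăilescu, *Primary cyclotomic units and a proof of Catalan's conjecture*, J. reine angew.
  Math. **572** (2004), 167–195 [Mihailescu2004].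
-/

namespace Literature.NumberTheory.DiophantineGeometry

namespace Catalan.Plus

variable {R : Type*} [CommRing R]

/-- **[Schoof2009, Exercise 14.1]**: if `A × B` is a free `R`-module of rank `1` then the
annihilators of `A` and `B` are coprime ideals, `Ann_R(A) + Ann_R(B) = R`. (With `e : A × B ≃ R`,
`I = e(A × 0)` and `J = e(0 × B)` are ideals with `I + J = R`, `I ∩ J = 0`, and `J ⊆ Ann(A)`,
`I ⊆ Ann(B)`.) [cite: Schoof2009, Exercise 14.1] -/
theorem annihilator_sup_annihilator_eq_top {A B : Type*} [AddCommGroup A] [Module R A]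
    [AddCommGroup B] [Module R B] (e : (A × B) ≃ₗ[R] R) :
    Module.annihilator R A ⊔ Module.annihilator R B = ⊤ := by
  -- `e(0,b')` kills `A` and `e(a',0)` kills `B`
  have key : ∀ (a' : A) (b' : B), e (0, b') • a' = 0 ∧ e (a', 0) • b' = 0 := by
    intro a' b'
    have h1 : e (e (0, b') • (a', (0 : B))) = e (e (a', 0) • ((0 : A), b')) := by
      rw [map_smul, map_smul, smul_eq_mul, smul_eq_mul, mul_comm]
    have h2 := e.injective h1
    rw [Prod.smul_mk, Prod.smul_mk, smul_zero, smul_zero, Prod.mk.injEq] at h2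
    exact ⟨h2.1, h2.2.symm⟩
  rw [eq_top_iff]
  rintro r -
  -- `r = e (a, b) = e (0, b) + e (a, 0)`
  obtain ⟨⟨a, b⟩, hab⟩ := e.surjective r
  have hsplit : r = e (0, b) + e (a, 0) := by
    rw [← hab, ← map_add, Prod.mk_add_mk, add_zero, zero_add]
  rw [hsplit]
  refine Submodule.add_mem_sup ?_ ?_
  · rw [Module.mem_annihilator]
    exact fun a' => (key a' b).1
  · rw [Module.mem_annihilator]
    exact fun b' => (key a b').2

/-- **The skeleton of [Schoof2009, Theorem 14.1].** Let `S ↪ E₁ × E₃ × C` be an injective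
`R`-linear map, suppose the annihilator of `E₃` annihilates `C` (Thaine's theorem, in
[Schoof2009] for `R = 𝔽_q[G⁺]`, `E₃ = E/CE^q`, `C = Cl⁺[q]`), that `(E₁ × E₃) × E₂` is free of
rank one (`E/E^q ≅ 𝔽_q[G⁺]`, [Schoof2009, Cor. 13.7]) and that `E₂ ≠ 0` ([Schoof2009, Prop. 14.2]).
Then `S` has a non-zero annihilator: `Ann(E₁ × E₃) = Ann(E₁) ∩ Ann(E₃)` kills `E₁ × E₃ × C`, hence
`S`; were it zero, [Schoof2009, Exercise 14.1] would give `Ann(E₂) = R`, i.e. `E₂ = 0`.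
[cite: Schoof2009, Theorem 14.1 (proof)] -/
theorem annihilator_ne_bot_of_embedding {S E₁ E₂ E₃ C : Type*} [AddCommGroup S] [Module R S]
    [AddCommGroup E₁] [Module R E₁] [AddCommGroup E₂] [Module R E₂] [AddCommGroup E₃]
    [Module R E₃] [AddCommGroup C] [Module R C] [Nontrivial E₂]
    (f : S →ₗ[R] E₁ × E₃ × C) (hf : Function.Injective f)
    (hT : Module.annihilator R E₃ ≤ Module.annihilator R C)
    (e : ((E₁ × E₃) × E₂) ≃ₗ[R] R) : Module.annihilator R S ≠ ⊥ := by
  -- `Ann(E₁ × E₃) ⊆ Ann(S)`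
  have h1 : Module.annihilator R (E₁ × E₃) ≤ Module.annihilator R S := by
    intro r hr
    rw [Module.mem_annihilator] at hr ⊢
    have hr1 : ∀ x : E₁, r • x = 0 := fun x => by
      have := hr (x, 0)
      rw [Prod.smul_mk, smul_zero, Prod.mk_eq_zero] at this
      exact this.1
    have hr3 : ∀ x : E₃, r • x = 0 := fun x => by
      have := hr (0, x)
      rw [Prod.smul_mk, smul_zero, Prod.mk_eq_zero] at this
      exact this.2
    have hrC : ∀ x : C, r • x = 0 := Module.mem_annihilator.mp (hT (Module.mem_annihilator.mpr hr3))
    intro s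
    apply hf
    rw [map_smul, map_zero]
    obtain ⟨x1, x3, xc⟩ := f s
    rw [Prod.smul_mk, Prod.smul_mk, hr1, hr3, hrC]
    rfl
  intro hbot
  have h2 : Module.annihilator R (E₁ × E₃) = ⊥ := le_bot_iff.mp (hbot ▸ h1)
  have h3 := annihilator_sup_annihilator_eq_top e
  rw [h2, bot_sup_eq] at h3
  -- `Ann(E₂) = R` forces `E₂ = 0`
  obtain ⟨x, hx⟩ := exists_ne (0 : E₂)
  have h4 : (1 : R) ∈ Module.annihilator R E₂ := by rw [h3]; trivial
  rw [Module.mem_annihilator] at h4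
  exact hx (by rw [← one_smul R x, h4])

end Catalan.Plus

end Literature.NumberTheory.DiophantineGeometry
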